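import Literature.Analysis.FluidPDE.SawtoothCascadeRobustCones
import HarnessLib
import Summits.AnomalousDissipation.AnomalousDissipation.Theses.SawtoothPulseCascade

/-!
# K1loc — helper: CONE NARROWING for the pulse-pair Jacobians (wide cone in, admissible cone out)

Helper file of the first prover lane on the crux `K1LocalisedCascade` (stmt-AnomalousDissipation-19491), route
`SawtoothPulseCascade` (architecture memo `K1loc-architecture-findings-k1locp1.md`, F-a / NET S3e).  The tree's robust cone
lemma `SawtoothCascade.robust_cone_step` keeps an aperture `m` in the ADMISSIBLE window `m(m+2) ≤ (mρ²−1)γ²` (i.e.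
`m ∈ [m_*, m^*]`, the roots of `m² − (ρ²γ²−2)m + γ² = 0`) and expands by `ρ²γ² − 1 − m`.  The backward symbol pullback
of the line needs more: frequency vectors that start in a WIDE cone (aperture up to `ρ²γ² − 1`) must end up, after a
bounded number of phases, in a thin admissible cone where the expansion `ρ²γ² − 1 − m` exceeds the pinned rate `γ² − 3`.
This file proves the one-step NARROWING estimate, with no threshold hypothesis at all:

* `cone_narrowing_step` — for `γ > 0`, `0 ≤ m₁`, `0 ≤ ρ ≤ |r|,|s| ≤ 1` with `ρ²γ² − 1 − m₁ > 0` and `γ|v₂| ≤ m₁|v₁|`: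
  `|(A v)₁| ≥ (ρ²γ² − 1 − m₁)|v₁|` and `γ|(A v)₂| ≤ ((γ² + m₁)/(ρ²γ² − 1 − m₁)) · |(A v)₁|`, `A = pulseJac γ r s`
  — the aperture map `m ↦ φ(m) = (γ² + m)/(ρ²γ² − 1 − m)`, which DEcreases the aperture exactly on the admissible window
  `(m_*, m^*)` and has the thin end `m_*` as its attracting fixed point (`γ = 5, ρ = 1`: `20 ↦ 11.25 ↦ 2.84 ↦ 1.32 ↦ 1.16 → m_* = 1.144…`,
  expansion `ρ²γ² − 1 − m → 22.86 > 22 = γ² − 3`);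
* `inUnstableCone_mono` — cones are monotone in the aperture;
* `cone_narrowing_step_of_le` — the form with a prescribed target aperture `m₂ ≥ φ(m₁)`.

WHAT THIS IS NOT: no statement about which frequency vectors of the cascade scalar lie in the wide cone (memo F-d/F-e).
[cite: ElgindiLissMattingly2025, §3.1 Lemma 3.1 and §1.2.2 (cones C_u and the cocycle Π A_{jᵢ})] [problem: turb]
-/

-- `Summit.<Summit>.<Problem>`: single-conjunct summit, the duplicate namespace segment is deliberate.
set_option linter.dupNamespace false

noncomputable section

namespace Summit.AnomalousDissipation.AnomalousDissipation.Theorems.SawtoothPulseCascade.K1Cone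

open Matrix
open Literature.Analysis.FluidPDE.SawtoothCascade

/-- Cones are monotone in the aperture. [folklore] -/
theorem inUnstableCone_mono {γ m m' : ℝ} (hmm' : m ≤ m') {v : Fin 2 → ℝ} (hv : InUnstableCone γ m v) :
    InUnstableCone γ m' v := by
  unfold InUnstableCone at hv ⊢
  exact hv.trans (mul_le_mul_of_nonneg_right hmm' (abs_nonneg _))

/-- **One-step cone narrowing** for `A(r,s) = pulseJac γ r s` with a slope floor `ρ ≤ |r|,|s| ≤ 1`: from the wide cone
`γ|v₂| ≤ m₁|v₁|` (any `0 ≤ m₁ < ρ²γ² − 1`) the first coordinate grows by `≥ ρ²γ² − 1 − m₁` and the image lies in the cone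
of aperture `φ(m₁) = (γ² + m₁)/(ρ²γ² − 1 − m₁)`.
[cite: ElgindiLissMattingly2025, §3.1 Lemma 3.1 (cone invariance and expansion)] -/
theorem cone_narrowing_step {γ m₁ ρ r s : ℝ} (hγ : 0 < γ) (hm₁ : 0 ≤ m₁) (hρ : 0 ≤ ρ)
    (hgap : 0 < ρ ^ 2 * γ ^ 2 - 1 - m₁) (hr : ρ ≤ |r|) (hr1 : |r| ≤ 1) (hs : ρ ≤ |s|) (hs1 : |s| ≤ 1)
    {v : Fin 2 → ℝ} (hv : InUnstableCone γ m₁ v) :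
    (ρ ^ 2 * γ ^ 2 - 1 - m₁) * |v 0| ≤ |(pulseJac γ r s *ᵥ v) 0| ∧
      InUnstableCone γ ((γ ^ 2 + m₁) / (ρ ^ 2 * γ ^ 2 - 1 - m₁)) (pulseJac γ r s *ᵥ v) := by
  have hag : |γ| = γ := abs_of_pos hγ
  rw [pulseJac_mulVec]
  unfold InUnstableCone at hv ⊢
  set x := v 0
  set y := v 1
  set x' := (1 + r * s * γ ^ 2) * x + r * γ * y with hx'
  set y' := s * γ * x + y with hy'
  have hx0 : 0 ≤ |x| := abs_nonneg x
  have hy0 : 0 ≤ |y| := abs_nonneg y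
  have hrs : ρ ^ 2 ≤ |r| * |s| := by nlinarith [abs_nonneg r, abs_nonneg s]
  -- `ρ²γ²|x| ≤ |x'| + |x| + γ|y|`
  have h1 : ρ ^ 2 * γ ^ 2 * |x| ≤ |x'| + |x| + γ * |y| := by
    have e : r * s * γ ^ 2 * x = x' - (x + r * γ * y) := by rw [hx']; ring
    have h0 : |r * s * γ ^ 2 * x| ≤ |x'| + |x + r * γ * y| := by rw [e]; exact abs_sub _ _
    have h2 : |x + r * γ * y| ≤ |x| + γ * |y| := by
      calc |x + r * γ * y| ≤ |x| + |r * γ * y| := abs_add_le _ _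
        _ = |x| + |r| * (γ * |y|) := by rw [abs_mul, abs_mul, hag]; ring
        _ ≤ |x| + 1 * (γ * |y|) := by gcongr
        _ = |x| + γ * |y| := by ring
    have h3 : |r * s * γ ^ 2 * x| = |r| * |s| * γ ^ 2 * |x| := by
      rw [abs_mul, abs_mul, abs_mul, abs_pow, hag]
    have h4 : ρ ^ 2 * γ ^ 2 * |x| ≤ |r| * |s| * γ ^ 2 * |x| := by
      have : 0 ≤ γ ^ 2 * |x| := by positivity
      nlinarith
    linarith
  -- `|y'| ≤ γ|x| + |y|`
  have h2 : |y'| ≤ γ * |x| + |y| := by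
    calc |y'| ≤ |s * γ * x| + |y| := abs_add_le _ _
      _ = |s| * (γ * |x|) + |y| := by rw [abs_mul, abs_mul, hag]; ring
      _ ≤ 1 * (γ * |x|) + |y| := by gcongr
      _ = γ * |x| + |y| := by ring
  have goal1 : (ρ ^ 2 * γ ^ 2 - 1 - m₁) * |x| ≤ |x'| := by nlinarith
  refine ⟨by simpa using goal1, ?_⟩
  -- `γ|y'| ≤ (γ² + m₁)|x| ≤ φ(m₁)|x'|`
  have h3 : γ * |y'| ≤ (γ ^ 2 + m₁) * |x| := by nlinarith
  have h4 : (γ ^ 2 + m₁) * |x| ≤ (γ ^ 2 + m₁) / (ρ ^ 2 * γ ^ 2 - 1 - m₁) * |x'| := by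
    rw [div_mul_eq_mul_div, le_div_iff₀ hgap]
    calc (γ ^ 2 + m₁) * |x| * (ρ ^ 2 * γ ^ 2 - 1 - m₁) = (γ ^ 2 + m₁) * ((ρ ^ 2 * γ ^ 2 - 1 - m₁) * |x|) := by ring
      _ ≤ (γ ^ 2 + m₁) * |x'| := mul_le_mul_of_nonneg_left goal1 (by positivity)
  show γ * |y'| ≤ (γ ^ 2 + m₁) / (ρ ^ 2 * γ ^ 2 - 1 - m₁) * |x'|
  exact h3.trans h4

/-- Cone narrowing with a prescribed target aperture `m₂ ≥ (γ² + m₁)/(ρ²γ² − 1 − m₁)`. [folklore] -/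
theorem cone_narrowing_step_of_le {γ m₁ m₂ ρ r s : ℝ} (hγ : 0 < γ) (hm₁ : 0 ≤ m₁) (hρ : 0 ≤ ρ)
    (hgap : 0 < ρ ^ 2 * γ ^ 2 - 1 - m₁) (hm₂ : (γ ^ 2 + m₁) / (ρ ^ 2 * γ ^ 2 - 1 - m₁) ≤ m₂)
    (hr : ρ ≤ |r|) (hr1 : |r| ≤ 1) (hs : ρ ≤ |s|) (hs1 : |s| ≤ 1)
    {v : Fin 2 → ℝ} (hv : InUnstableCone γ m₁ v) :
    (ρ ^ 2 * γ ^ 2 - 1 - m₁) * |v 0| ≤ |(pulseJac γ r s *ᵥ v) 0| ∧ InUnstableCone γ m₂ (pulseJac γ r s *ᵥ v) := by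
  obtain ⟨h1, h2⟩ := cone_narrowing_step hγ hm₁ hρ hgap hr hr1 hs hs1 hv
  exact ⟨h1, inUnstableCone_mono hm₂ h2⟩

/-- The aperture map DEcreases the aperture exactly on the admissible window: for `m` with
`m(m + 2) < (mρ² − 1)γ²` (strictly inside the window of `robust_cone_step`) one has
`(γ² + m)/(ρ²γ² − 1 − m) < m`. [folklore] -/
theorem aperture_map_lt {γ m ρ : ℝ} (hgap : 0 < ρ ^ 2 * γ ^ 2 - 1 - m)
    (hwin : m * (m + 2) < (m * ρ ^ 2 - 1) * γ ^ 2) :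
    (γ ^ 2 + m) / (ρ ^ 2 * γ ^ 2 - 1 - m) < m := by
  rw [div_lt_iff₀ hgap]
  nlinarith

/-- Inside the admissible window the gap hypothesis is automatic: `m(m+2) ≤ (mρ²−1)γ²` with `γ, m > 0` forces
`ρ²γ² − 1 − m > 0` (indeed `m(ρ²γ² − 1 − m) ≥ γ² + m`). [folklore] -/
theorem gap_pos_of_window {γ m ρ : ℝ} (hγ : 0 < γ) (hm : 0 < m)
    (hwin : m * (m + 2) ≤ (m * ρ ^ 2 - 1) * γ ^ 2) : 0 < ρ ^ 2 * γ ^ 2 - 1 - m := by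
  have hγ2 : 0 < γ ^ 2 := by positivity
  have h1 : γ ^ 2 + m ≤ m * (ρ ^ 2 * γ ^ 2 - 1 - m) := by nlinarith
  by_contra h
  have h' : ρ ^ 2 * γ ^ 2 - 1 - m ≤ 0 := le_of_not_gt h
  nlinarith [mul_nonpos_of_nonneg_of_nonpos hm.le h']

end Summit.AnomalousDissipation.AnomalousDissipation.Theorems.SawtoothPulseCascade.K1Cone
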